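import Summits.QuantumFields.BalabanUV.Beta.FP.RoadEndLeft
import Summits.QuantumFields.BalabanUV.Beta.FP.SymJetDressingUnits
import Summits.QuantumFields.BalabanUV.Beta.SymmetrisedStepJets

/-!
# `BalabanUV.Beta.FP.RoadEndLeftUndressed` — road «FP» for binder row D1, COMPANION to the owner's `FP/RoadEndLeft` (p255849 ✓, R-FP-40 (A)∕(B)):
# AT THE LITERAL OF RECORD `JsB12Sym = dressSymAt ρ_c ∘ JsB12Sym⁰` THE DISPLAYED (CONV-C) S∕W ROWS MAY BE ASKED OF THE **UNDRESSED** UNIT-RESCALED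
# JETS OF `JsB12Sym⁰` — the (0.4) dressing costs only the constants `cKb²·cKb′` (stencils) ∕ `cKb²` (tables), rates and ratios unchanged
# (R-FP-40 (A8) «instance rows may be supplied on UNDRESSED tables and dressed afterwards», made a theorem for the wall rows)

HONEST DEPENDENCY (page 1, mandatory): continuum YM on T⁴ ⇐ BetaPertH ∧ nine spine estimates (0/9 proved); BetaPertH ⇐ (D1) ∧ (D4) ∧ CAP+tail;
G-an2-4 gates asym, D1 and NE2/3/4.  HONEST FRAMING (cell contract, verbatim): «discharging `BetaPertH` makes Bałaban's UV stability UNCONDITIONAL —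
a real constructive-QFT result; it is NOT the continuum limit and NOT the Clay problem.»  THIS MODULE DISCHARGES NOTHING of the wall: it is [folklore] class
transport (an2's `locStencil_dressKSymAt`∕`locStencil_coProjSymAtK`∕`biLoc_dressKSymAt`, the owner's row #21 `unitS_dressSym`∕`unitW_dressSym`∕
`locStencil_dressSym_sub`∕`vertexFamily₂_dressSym_sub`) + [our object] INSTANCES of the owner's `RoadEndLeft.d1Drift_iff_left_of_convCKWall`∕
`d1Drift_left_of_step_law_wslot_split` at `Js := JsB12Sym hLc Ncol tabs cΛ cB` BY NAME.  What stays DISPLAYED: the four (CONV-C) S∕W rows — now of the UNDRESSED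
unit-rescaled families `unitS_j (JsB12Sym0 … j).S`, `unitW_j (JsB12Sym0 … j).W` (row G-an2-4, NOT proved) — with their six range letters, STEP, the W-slot split data,
(ASYMP) at the bi-vertex kernel, all VERBATIM from `RoadEndLeft`.  No `def`, no `def … : Prop`, nothing cited, 0 sorry; 0∕4 row-D1 binders; NOT (CONV-C), NOT STEP,
NOT (ASYMP), NOT D1, NOT BetaPertH, NOT continuum, NOT Clay.  «not in print; our bookkeeping».

ABSOLUTE RULE (cell charter, verbatim): «No internally-minted statement may enter as a cited fact. Every hypothesis is either kernel-proved in this package or a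
verbatim quotation of a PUBLISHED theorem with page reference. The manuscript(s) under audit are NOT citable for their own disputed steps — they are the thing
under adjudication; programme-internal (2001/route/tribunal) claims are never citable.»

WHAT (d = 3, `Odd Lc`, `[NeZero Lc]`; the literal `JsB12Sym hLc Ncol tabs cΛ cB : ℕ → JetData 3 Lc` of an2's `SymmetrisedStepJets`;
colour parameter `Ncol : ℕ`, drift parameter `N : ℝ` — owner l.29199 (ii)).
* §1 [folklore] `unitS_JsB12Sym_eq_dress`, `unitW_JsB12Sym_eq_dress` — the SUBJECTS of the wall's S∕W rows at the literal ARE the (0.4) dressings (centred root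
  `toSite (ctrOff 4 Lc)`, blocking `Lc`) of the UNDRESSED unit-rescaled jets, for ANY units: `unitS sf sm (JsB12Sym … j).S = Π̂ (Π̂ᵀ_bond (unitS sf sm (JsB12Sym0 … j).S)) Π̂ᵀ`,
  `unitW sf sm (JsB12Sym … j).W = Π̂ (unitW sf sm (JsB12Sym0 … j).W) Π̂ᵀ` (`JsB12Sym_apply`∕`dressSymAt_S∕_W` are `rfl`; the commutation is the owner's row #21).
* §1b [folklore] (v1.1 append, trailing section) `JsB12Sym_S_translate`, `JsB12Sym_W_translate`, `JsB12Sym_S_translate_pow_one` — (St)(Wt) for the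
  DRESSED literal (an2's `JsB12Sym0_S∕W_translate` through his `dressSymAtS∕W_translate`): the literal side of row #4's covariance letter at `m = 1`
  (`FP/PerfectJetLetters.sPerf_letters_of_rows`, hypothesis `hcov 1`).
* §2 [folklore] THE ROWS TRANSFER (any units `sf sm : ℕ → ℝ`): `sRow_JsB12Sym_of_undressed` (`j`-uniform `LocStencil`, constant × `cKb δ·(cKb δ·cKb′ δ)`),
  `sRowAll_JsB12Sym_of_undressed` (all-scales deviations, same factor, ratio `θ` unchanged), `wRow_JsB12Sym_of_undressed`, `wRowAll_JsB12Sym_of_undressed`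
  (tables at window `Lc`, factor `cKb δ·cKb δ`).
* §3 [our object] AT THE ADOPTED UNITS `(sfStep Lc, smStep 3 Lc)`, `2 ≤ Lc`: **`d1Drift_iff_JsB12Sym_of_undressed_rows`** — the owner's §3 at the literal with the S∕W rows
  asked of the UNDRESSED families (conclusion unchanged: `D1Drift Lc (JsB12Sym …) N μ ν ↔ secondMoment (hessKer (KPerf 1) (vertexOfK (KPerf 1) Lc S∞) W∞) μ ν = stepBal N Lc`,
  `S∞`∕`W∞` the constructed unit-limits of the literal's OWN dressed jets); **`d1Drift_JsB12Sym_of_undressed_rows_step_law_wslot_split`** — the owner's §5 at the literal,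
  rows undressed, STEP ∕ W-split ∕ (ASYMP)-at-the-bi-vertex-kernel binders VERBATIM.
Provenance: D1 formalisation swarm LEAF PROVER 06, unit b2b-balaban-beta-d1-formalise-leaf-06 gen 11 (prover-b2b-balaban-beta-d1-formalise-leaf-06-g11-0),
2026-08-21; companion to the road-FP owner's `RoadEndLeft` (INTENT O-g11-3 l.29161; owner «GO, THIS SHAPE» l.29199); nothing of the owner's or an2's restated — their theorems are CALLED by name.
-/

noncomputable section

namespace Summit.QuantumFields.BalabanUV.Beta.FP.RoadEndLeftUndressed

open Literature.MathematicalPhysics.QuantumFieldTheory.Balaban1983to89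
open Literature.MathematicalPhysics.QuantumFieldTheory.Balaban1983to89.Beta
open Literature.MathematicalPhysics.QuantumFieldTheory.Balaban1983to89.B12Normalization (stepBal)
open ExpKernelCalculus (Site MKer VertexFamily₂ tadpole hessKer)
open OneStepResolventKernel (Fib LocStencil JetData)
open OneStepKernelFamily (vertexOfK D1Drift)
open SecondOrderResponse (vertex2OfK)
open HessKerDressedLimit (limStOf limTabOf)
open AffineAveraging (box toSite)
open AveragingContoursRooted (ctrOff ctrOff_mem_box)
open Summit.QuantumFields.BalabanUV.Beta.HessKerDressedUnits (unitS unitW)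
open Summit.QuantumFields.BalabanUV.Beta.TameKernelCalculus (Loc)
open Summit.QuantumFields.BalabanUV.Beta.AxialDressingRooted (cKb cKb' one_le_of_neZero)
open Summit.QuantumFields.BalabanUV.Beta.SymmetrisedDressingKernel (dressKSymAt)
open Summit.QuantumFields.BalabanUV.Beta.SymmetrisedDressingLegs (biLoc_dressKSymAt)
open Summit.QuantumFields.BalabanUV.Beta.SymmetrisedDressingDress (coProjSymAtK locStencil_coProjSymAtK locStencil_dressKSymAt)
open Summit.QuantumFields.BalabanUV.Beta.SymmetrisedStepJets (SymTables JsB12Sym0 JsB12Sym)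
open Summit.QuantumFields.BalabanUV.Beta.GAN24.CombesThomas (sfStep smStep)
open Summit.QuantumFields.BalabanUV.Beta.FP.PerfectObjects (KTot)
open Summit.QuantumFields.BalabanUV.Beta.FP.PerfectObjectsT (KPerf SPerfOf WPerfOf)
open Summit.QuantumFields.BalabanUV.Beta.FP.RoadEndGeneric (fPerfG)
open Summit.QuantumFields.BalabanUV.Beta.FP.SymJetDressingUnits (unitS_dressSym unitW_dressSym locStencil_dressSym_sub vertexFamily₂_dressSym_sub)
open Summit.QuantumFields.BalabanUV.Beta.FP.RoadEndLeft (d1Drift_iff_left_of_convCKWall d1Drift_left_of_step_law_wslot_split)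

variable {Lc : ℕ} [NeZero Lc] (hLc : Odd Lc) (Ncol : ℕ) (tabs : SymTables 3 Lc) (cΛ cB : ℝ)

/-! ## §1 The subjects of the wall rows at the literal are dressings of the undressed unit-rescaled jets -/

section Subjects

/-- [folklore] **THE UNIT-RESCALED STENCIL OF THE LITERAL IS THE (0.4) DRESSING OF THE UNIT-RESCALED UNDRESSED STENCIL** (any units; centred root, blocking `Lc`):
`unitS sf sm (JsB12Sym … j).S = fun κ u => dressKSymAt ρ_c Lc (coProjSymAtK ρ_c Lc (unitS sf sm (JsB12Sym0 … j).S) κ u)` — `JsB12Sym_apply`∕`dressSymAt_S` by `rfl`,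
the commutation by the owner's `SymJetDressingUnits.unitS_dressSym`. -/
theorem unitS_JsB12Sym_eq_dress (j : ℕ) (sf sm : ℝ) :
    unitS sf sm (JsB12Sym hLc Ncol tabs cΛ cB j).S =
      fun κ u => dressKSymAt (toSite (ctrOff 4 Lc)) Lc (coProjSymAtK (toSite (ctrOff 4 Lc)) Lc (unitS sf sm (JsB12Sym0 hLc Ncol tabs cΛ cB j).S) κ u) :=
  unitS_dressSym _ _ sf sm (JsB12Sym0 hLc Ncol tabs cΛ cB j).S

/-- [folklore] **THE UNIT-RESCALED TABLES OF THE LITERAL ARE THE (0.4) DRESSINGS OF THE UNIT-RESCALED UNDRESSED TABLES**, member by member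
(`unitW_dressSym`). -/
theorem unitW_JsB12Sym_eq_dress (j : ℕ) (sf sm : ℝ) :
    unitW sf sm (JsB12Sym hLc Ncol tabs cΛ cB j).W =
      fun μ y ν y' => dressKSymAt (toSite (ctrOff 4 Lc)) Lc (unitW sf sm (JsB12Sym0 hLc Ncol tabs cΛ cB j).W μ y ν y') :=
  unitW_dressSym _ _ sf sm (JsB12Sym0 hLc Ncol tabs cΛ cB j).W

end Subjects

/-! ## §2 The four wall rows transfer from the undressed families (any units) -/

section Rows

variable (sf sm : ℕ → ℝ)

/-- [folklore] **S-ROW, UNIFORM CLASS**: a `j`-uniform `LocStencil` letter of the undressed unit-rescaled stencils gives one for the literal's, constant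
× `cKb δ·(cKb δ·cKb′ δ)`, same rate (an2's `locStencil_dressKSymAt ∘ locStencil_coProjSymAtK`). -/
theorem sRow_JsB12Sym_of_undressed {Cs δS : ℝ} (hδS : 0 ≤ δS)
    (hS0 : ∀ j, LocStencil (unitS (sf j) (sm j) (JsB12Sym0 hLc Ncol tabs cΛ cB j).S) Cs δS) (j : ℕ) :
    LocStencil (unitS (sf j) (sm j) (JsB12Sym hLc Ncol tabs cΛ cB j).S) (cKb 3 Lc δS * (cKb 3 Lc δS * (cKb' 3 Lc δS * Cs))) δS := by
  rw [unitS_JsB12Sym_eq_dress]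
  exact locStencil_dressKSymAt (one_le_of_neZero Lc) (ctrOff_mem_box (one_le_of_neZero Lc))
    (locStencil_coProjSymAtK (one_le_of_neZero Lc) (ctrOff_mem_box (one_le_of_neZero Lc)) (hS0 j) hδS) hδS

/-- [folklore] **S-ROW, ALL-SCALES DEVIATIONS**: the all-scales letter of the undressed unit-rescaled stencils (ratio `θS`, rate `δS > 0`) gives the literal's
with constant × `cKb δ·(cKb δ·cKb′ δ)`, SAME ratio and rate (the owner's `locStencil_dressSym_sub`). -/
theorem sRowAll_JsB12Sym_of_undressed {Cs cS δS θS : ℝ} (hδS : 0 < δS)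
    (hS0 : ∀ j, LocStencil (unitS (sf j) (sm j) (JsB12Sym0 hLc Ncol tabs cΛ cB j).S) Cs δS)
    (hSall0 : ∀ k j, LocStencil (unitS (sf (k + j)) (sm (k + j)) (JsB12Sym0 hLc Ncol tabs cΛ cB (k + j)).S -
      unitS (sf k) (sm k) (JsB12Sym0 hLc Ncol tabs cΛ cB k).S) (cS * θS ^ k) δS) (k j : ℕ) :
    LocStencil (unitS (sf (k + j)) (sm (k + j)) (JsB12Sym hLc Ncol tabs cΛ cB (k + j)).S -
      unitS (sf k) (sm k) (JsB12Sym hLc Ncol tabs cΛ cB k).S) (cKb 3 Lc δS * (cKb 3 Lc δS * (cKb' 3 Lc δS * cS)) * θS ^ k) δS := by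
  rw [unitS_JsB12Sym_eq_dress, unitS_JsB12Sym_eq_dress]
  have h := locStencil_dressSym_sub (one_le_of_neZero Lc) (ctrOff_mem_box (one_le_of_neZero Lc)) (hS0 (k + j)) hδS (hS0 k) hδS
    (hSall0 k j) hδS.le
  have e : cKb 3 Lc δS * (cKb 3 Lc δS * (cKb' 3 Lc δS * (cS * θS ^ k))) = cKb 3 Lc δS * (cKb 3 Lc δS * (cKb' 3 Lc δS * cS)) * θS ^ k := by ring
  rw [e] at h
  exact h

/-- [folklore] **W-ROW, UNIFORM CLASS** (window `Lc`): constant × `cKb δ·cKb δ`, same rate (an2's `biLoc_dressKSymAt`, member by member). -/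
theorem wRow_JsB12Sym_of_undressed {Cw δW : ℝ} (hδW : 0 ≤ δW)
    (hW0 : ∀ j, VertexFamily₂ (unitW (sf j) (sm j) (JsB12Sym0 hLc Ncol tabs cΛ cB j).W) Lc Cw δW) (j : ℕ) :
    VertexFamily₂ (unitW (sf j) (sm j) (JsB12Sym hLc Ncol tabs cΛ cB j).W) Lc (cKb 3 Lc δW * (cKb 3 Lc δW * Cw)) δW := by
  rw [unitW_JsB12Sym_eq_dress]
  exact fun μ y ν y' => biLoc_dressKSymAt (one_le_of_neZero Lc) (ctrOff_mem_box (one_le_of_neZero Lc)) (hW0 j μ y ν y') hδW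

/-- [folklore] **W-ROW, ALL-SCALES DEVIATIONS**: constant × `cKb δ·cKb δ`, SAME ratio and rate (the owner's `vertexFamily₂_dressSym_sub`). -/
theorem wRowAll_JsB12Sym_of_undressed {Cw cW δW θW : ℝ} (hδW : 0 < δW)
    (hW0 : ∀ j, VertexFamily₂ (unitW (sf j) (sm j) (JsB12Sym0 hLc Ncol tabs cΛ cB j).W) Lc Cw δW)
    (hWall0 : ∀ k j, VertexFamily₂ (unitW (sf (k + j)) (sm (k + j)) (JsB12Sym0 hLc Ncol tabs cΛ cB (k + j)).W -
      unitW (sf k) (sm k) (JsB12Sym0 hLc Ncol tabs cΛ cB k).W) Lc (cW * θW ^ k) δW) (k j : ℕ) :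
    VertexFamily₂ (unitW (sf (k + j)) (sm (k + j)) (JsB12Sym hLc Ncol tabs cΛ cB (k + j)).W -
      unitW (sf k) (sm k) (JsB12Sym hLc Ncol tabs cΛ cB k).W) Lc (cKb 3 Lc δW * (cKb 3 Lc δW * cW) * θW ^ k) δW := by
  rw [unitW_JsB12Sym_eq_dress, unitW_JsB12Sym_eq_dress]
  have h := vertexFamily₂_dressSym_sub (one_le_of_neZero Lc) (ctrOff_mem_box (one_le_of_neZero Lc)) (hW0 (k + j)) hδW (hW0 k) hδW
    (hWall0 k j) hδW.le
  have e : cKb 3 Lc δW * (cKb 3 Lc δW * (cW * θW ^ k)) = cKb 3 Lc δW * (cKb 3 Lc δW * cW) * θW ^ k := by ring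
  rw [e] at h
  exact h

end Rows

/-! ## §3 The owner's ENDs at the literal, the S∕W rows asked of the UNDRESSED families -/

section End

variable {Cs cS δS θS Cw cW δW θW : ℝ}

/-- [our object] **THE WALL ⟺ THE IDENTIFICATION AT THE LEFT PERFECT OBJECTS, FOR THE LITERAL OF RECORD, K-SLOT GONE, S∕W ROWS UNDRESSED** (`d = 3`, `Odd Lc`,
`2 ≤ Lc`, adopted units `(sfStep Lc, smStep 3 Lc)`): the owner's `RoadEndLeft.d1Drift_iff_left_of_convCKWall` at `Js := JsB12Sym hLc Ncol tabs cΛ cB` with its four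
displayed S∕W rows (row G-an2-4, NOT proved) asked of the UNDRESSED unit-rescaled jets `unitS_j (JsB12Sym0 … j).S`, `unitW_j (JsB12Sym0 … j).W` (§2 transports
them; rates∕ratios unchanged).  CONCLUSION unchanged: `D1Drift Lc (JsB12Sym …) N μ ν ↔ secondMoment (hessKer (KPerf 1) (vertexOfK (KPerf 1) Lc S∞) W∞) μ ν = stepBal N Lc`
with `S∞`, `W∞` the constructed unit-limits of the literal's OWN (dressed) jets. -/
theorem d1Drift_iff_JsB12Sym_of_undressed_rows (hL2 : 2 ≤ Lc)
    (hS0 : ∀ j, LocStencil (unitS (sfStep Lc j) (smStep 3 Lc j) (JsB12Sym0 hLc Ncol tabs cΛ cB j).S) Cs δS)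
    (hSall0 : ∀ k j, LocStencil (unitS (sfStep Lc (k + j)) (smStep 3 Lc (k + j)) (JsB12Sym0 hLc Ncol tabs cΛ cB (k + j)).S -
      unitS (sfStep Lc k) (smStep 3 Lc k) (JsB12Sym0 hLc Ncol tabs cΛ cB k).S) (cS * θS ^ k) δS)
    (hW0 : ∀ j, VertexFamily₂ (unitW (sfStep Lc j) (smStep 3 Lc j) (JsB12Sym0 hLc Ncol tabs cΛ cB j).W) Lc Cw δW)
    (hWall0 : ∀ k j, VertexFamily₂ (unitW (sfStep Lc (k + j)) (smStep 3 Lc (k + j)) (JsB12Sym0 hLc Ncol tabs cΛ cB (k + j)).W -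
      unitW (sfStep Lc k) (smStep 3 Lc k) (JsB12Sym0 hLc Ncol tabs cΛ cB k).W) Lc (cW * θW ^ k) δW)
    (hδS : 0 < δS) (hδW : 0 < δW) (hθS0 : 0 ≤ θS) (hθS1 : θS < 1) (hθW0 : 0 ≤ θW) (hθW1 : θW < 1) (μ ν : Fin 4) (N : ℝ) :
    D1Drift Lc (JsB12Sym hLc Ncol tabs cΛ cB) N μ ν ↔
      B12Beta.secondMoment (hessKer (KPerf (d := 3) Lc (sfStep Lc) (smStep 3 Lc) 1)
        (vertexOfK (KPerf (d := 3) Lc (sfStep Lc) (smStep 3 Lc) 1) Lc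
          (limStOf fun j => unitS (sfStep Lc j) (smStep 3 Lc j) (JsB12Sym hLc Ncol tabs cΛ cB j).S))
        (limTabOf fun j => unitW (sfStep Lc j) (smStep 3 Lc j) (JsB12Sym hLc Ncol tabs cΛ cB j).W)) μ ν = stepBal N Lc :=
  d1Drift_iff_left_of_convCKWall (JsB12Sym hLc Ncol tabs cΛ cB) hL2
    (sRow_JsB12Sym_of_undressed hLc Ncol tabs cΛ cB (sfStep Lc) (smStep 3 Lc) hδS.le hS0)
    (sRowAll_JsB12Sym_of_undressed hLc Ncol tabs cΛ cB (sfStep Lc) (smStep 3 Lc) hδS hS0 hSall0)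
    (wRow_JsB12Sym_of_undressed hLc Ncol tabs cΛ cB (sfStep Lc) (smStep 3 Lc) hδW.le hW0)
    (wRowAll_JsB12Sym_of_undressed hLc Ncol tabs cΛ cB (sfStep Lc) (smStep 3 Lc) hδW hW0 hWall0)
    hδS hδW hθS0 hθS1 hθW0 hθW1 μ ν N

/-- **ROAD «FP», THE END AT THE LITERAL OF RECORD WITH THE W-SLOT SPLIT, K-SLOT GONE, S∕W ROWS UNDRESSED** [our object] (`d = 3`, `Odd Lc`, `2 ≤ Lc`, adopted
units).  The owner's `RoadEndLeft.d1Drift_left_of_step_law_wslot_split` at `Js := JsB12Sym hLc Ncol tabs cΛ cB`: the (j, m)-families `(S, Wt)` pinned at `m = 1` to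
the literal's OWN (dressed) jets; DISPLAYED — the four (CONV-C) S∕W rows of the UNDRESSED unit-rescaled jets of `JsB12Sym0` (row G-an2-4; HYPOTHESES) with their
six range letters, the STEP LAW of the LEFT perfect coefficient family (shared crux), the W-slot split of the perfect second-order slot with its `Loc`∕`MomentSummable`
letters and the extra piece's bound `B` (rows #14∕(G8)∕(G-mix-W)), and (ASYMP) AT THE BI-VERTEX KERNEL (the (LEDGER) skeleton's LEFT conclusion) — all VERBATIM
from the owner's statement.  CONCLUSION: `D1Drift Lc (JsB12Sym hLc Ncol tabs cΛ cB) N μ ν`.  Discharges nothing else. -/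
theorem d1Drift_JsB12Sym_of_undressed_rows_step_law_wslot_split (hL2 : 2 ≤ Lc)
    (S : ℕ → ℕ → Fin (3 + 1) → (Fin (3 + 1) → ℤ) → MKer (3 + 1) (Fib 3))
    (Wt : ℕ → ℕ → Fin (3 + 1) → (Fin (3 + 1) → ℤ) → Fin (3 + 1) → (Fin (3 + 1) → ℤ) → MKer (3 + 1) (Fib 3))
    (hS1 : ∀ j, S j 1 = (JsB12Sym hLc Ncol tabs cΛ cB j).S) (hW1 : ∀ j, Wt j 1 = (JsB12Sym hLc Ncol tabs cΛ cB j).W)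
    -- the (CONV-C) S∕W rows of the UNDRESSED unit-rescaled jets (row G-an2-4; HYPOTHESES)
    (hS0 : ∀ j, LocStencil (unitS (sfStep Lc j) (smStep 3 Lc j) (JsB12Sym0 hLc Ncol tabs cΛ cB j).S) Cs δS)
    (hSall0 : ∀ k j, LocStencil (unitS (sfStep Lc (k + j)) (smStep 3 Lc (k + j)) (JsB12Sym0 hLc Ncol tabs cΛ cB (k + j)).S -
      unitS (sfStep Lc k) (smStep 3 Lc k) (JsB12Sym0 hLc Ncol tabs cΛ cB k).S) (cS * θS ^ k) δS)
    (hW0 : ∀ j, VertexFamily₂ (unitW (sfStep Lc j) (smStep 3 Lc j) (JsB12Sym0 hLc Ncol tabs cΛ cB j).W) Lc Cw δW)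
    (hWall0 : ∀ k j, VertexFamily₂ (unitW (sfStep Lc (k + j)) (smStep 3 Lc (k + j)) (JsB12Sym0 hLc Ncol tabs cΛ cB (k + j)).W -
      unitW (sfStep Lc k) (smStep 3 Lc k) (JsB12Sym0 hLc Ncol tabs cΛ cB k).W) Lc (cW * θW ^ k) δW)
    (hδS : 0 < δS) (hδW : 0 < δW) (hθS0 : 0 ≤ θS) (hθS1 : θS < 1) (hθW0 : 0 ≤ θW) (hθW1 : θW < 1) (μ ν : Fin 4) {N : ℝ}
    -- STEP (shared crux) for the LEFT perfect coefficient family at the standard resolvent families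
    (hstep : ∀ m : ℕ, 1 ≤ m →
      fPerfG Lc (sfStep Lc) (smStep 3 Lc) (fun j m => KTot (d := 3) (Lc ^ (j + m)) (Lc ^ j)) (fun j m => KTot (d := 3) (Lc ^ (j + m)) (Lc ^ j))
          S Wt μ ν (m + 1) =
        fPerfG Lc (sfStep Lc) (smStep 3 Lc) (fun j m => KTot (d := 3) (Lc ^ (j + m)) (Lc ^ j)) (fun j m => KTot (d := 3) (Lc ^ (j + m)) (Lc ^ j))
            S Wt μ ν m +
          fPerfG Lc (sfStep Lc) (smStep 3 Lc) (fun j m => KTot (d := 3) (Lc ^ (j + m)) (Lc ^ j)) (fun j m => KTot (d := 3) (Lc ^ (j + m)) (Lc ^ j))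
            S Wt μ ν 1)
    -- the W-slot split of the perfect second-order slot (row #14), with its letters
    {Wf Wx : ℕ → Fin (3 + 1) → (Fin (3 + 1) → ℤ) → Fin (3 + 1) → (Fin (3 + 1) → ℤ) → MKer (3 + 1) (Fib 3)}
    (hsplit : ∀ m : ℕ, 1 ≤ m →
      WPerfOf (sfStep Lc) (smStep 3 Lc) Wt m = vertex2OfK (KPerf (d := 3) Lc (sfStep Lc) (smStep 3 Lc) m) (Lc ^ m) (Wf m) + Wx m)
    (hloc₀ : ∀ m : ℕ, 1 ≤ m → ∀ z, Loc (vertex2OfK (KPerf (d := 3) Lc (sfStep Lc) (smStep 3 Lc) m) (Lc ^ m) (Wf m) μ 0 ν z))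
    (hlocx : ∀ m : ℕ, 1 ≤ m → ∀ z, Loc (Wx m μ 0 ν z))
    (hs₀ : ∀ m : ℕ, 1 ≤ m → B14DeltaBeta.MomentSummable
      (hessKer (KPerf (d := 3) Lc (sfStep Lc) (smStep 3 Lc) m)
        (vertexOfK (KPerf (d := 3) Lc (sfStep Lc) (smStep 3 Lc) m) (Lc ^ m) (SPerfOf (sfStep Lc) (smStep 3 Lc) S m))
        (vertex2OfK (KPerf (d := 3) Lc (sfStep Lc) (smStep 3 Lc) m) (Lc ^ m) (Wf m))) μ ν)
    (hsx : ∀ m : ℕ, 1 ≤ m → B14DeltaBeta.MomentSummable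
      (fun μ' ν' z => (1 / 2 : ℝ) * tadpole (KPerf (d := 3) Lc (sfStep Lc) (smStep 3 Lc) m) (Wx m μ' 0 ν' z)) μ ν)
    {Cg B : ℝ}
    -- (ASYMP) at the bi-vertex kernel (the (LEDGER) skeleton's LEFT conclusion) and the extra piece's bound
    (hasym₀ : ∀ m : ℕ, 1 ≤ m →
      |B12Beta.secondMoment (hessKer (KPerf (d := 3) Lc (sfStep Lc) (smStep 3 Lc) m)
          (vertexOfK (KPerf (d := 3) Lc (sfStep Lc) (smStep 3 Lc) m) (Lc ^ m) (SPerfOf (sfStep Lc) (smStep 3 Lc) S m))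
          (vertex2OfK (KPerf (d := 3) Lc (sfStep Lc) (smStep 3 Lc) m) (Lc ^ m) (Wf m))) μ ν - (m : ℝ) * stepBal N Lc| ≤ Cg)
    (hextra : ∀ m : ℕ, 1 ≤ m →
      |B12Beta.secondMoment
          (fun μ' ν' z => (1 / 2 : ℝ) * tadpole (KPerf (d := 3) Lc (sfStep Lc) (smStep 3 Lc) m) (Wx m μ' 0 ν' z)) μ ν| ≤ B) :
    D1Drift Lc (JsB12Sym hLc Ncol tabs cΛ cB) N μ ν :=
  d1Drift_left_of_step_law_wslot_split (JsB12Sym hLc Ncol tabs cΛ cB) S Wt hL2 hS1 hW1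
    (sRow_JsB12Sym_of_undressed hLc Ncol tabs cΛ cB (sfStep Lc) (smStep 3 Lc) hδS.le hS0)
    (sRowAll_JsB12Sym_of_undressed hLc Ncol tabs cΛ cB (sfStep Lc) (smStep 3 Lc) hδS hS0 hSall0)
    (wRow_JsB12Sym_of_undressed hLc Ncol tabs cΛ cB (sfStep Lc) (smStep 3 Lc) hδW.le hW0)
    (wRowAll_JsB12Sym_of_undressed hLc Ncol tabs cΛ cB (sfStep Lc) (smStep 3 Lc) hδW hW0 hWall0)
    hδS hδW hθS0 hθS1 hθW0 hθW1 μ ν hstep hsplit hloc₀ hlocx hs₀ hsx hasym₀ hextra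

end End

/-! ## §1b (v1.1 append) The translation letters (St)(Wt) of the DRESSED literal — the literal side of row #4's covariance letter at `m = 1` -/

section Translate

open Summit.QuantumFields.BalabanUV.Beta.SymmetrisedDressingDress (dressSymAtS_translate dressSymAtW_translate)
open Summit.QuantumFields.BalabanUV.Beta.SymmetrisedStepJets (JsB12Sym0_S_translate JsB12Sym0_W_translate)

/-- [folklore] **(St) FOR THE DRESSED LITERAL** (v1.1; offer O-g11-4, an2∕an1's first refusal lapsed in silence): `(JsB12Sym … j).S κ (u + Lc•t) = shiftK (−Lc•t) ((JsB12Sym … j).S κ u)`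
— an2's (St) for `JsB12Sym⁰` (`SymmetrisedStepJets.JsB12Sym0_S_translate`) passed through his dressing-covariance lemma `SymmetrisedDressingDress.dressSymAtS_translate`
(block-periodicity of `pmSymBm`); `JsB12Sym_apply`∕`dressSymAt_S` are `rfl`.  With `pow_one` this is the hypothesis `hcov 1` of the owner's
`PerfectJetLetters.sPerf_letters_of_rows` for the raw member `S j 1 := (JsB12Sym … j).S`. -/
theorem JsB12Sym_S_translate (j : ℕ) (κ : Fin 4) (u t : Fin 4 → ℤ) :
    (JsB12Sym hLc Ncol tabs cΛ cB j).S κ (u + (Lc : ℤ) • t) =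
      ExpKernelCalculus.shiftK (-((Lc : ℤ) • t)) ((JsB12Sym hLc Ncol tabs cΛ cB j).S κ u) :=
  dressSymAtS_translate _ (one_le_of_neZero Lc) (JsB12Sym0_S_translate hLc Ncol tabs cΛ cB j) κ u t

/-- [folklore] **(Wt) FOR THE DRESSED LITERAL** (v1.1): `(JsB12Sym … j).W μ (y + t) ν (y′ + t) = shiftK (−Lc•t) ((JsB12Sym … j).W μ y ν y′)`
(`dressSymAtW_translate` ∘ `JsB12Sym0_W_translate`). -/
theorem JsB12Sym_W_translate (j : ℕ) (μ : Fin 4) (y : Fin 4 → ℤ) (ν : Fin 4) (y' t : Fin 4 → ℤ) :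
    (JsB12Sym hLc Ncol tabs cΛ cB j).W μ (y + t) ν (y' + t) =
      ExpKernelCalculus.shiftK (-((Lc : ℤ) • t)) ((JsB12Sym hLc Ncol tabs cΛ cB j).W μ y ν y') :=
  dressSymAtW_translate _ (one_le_of_neZero Lc) (JsB12Sym0_W_translate hLc Ncol tabs cΛ cB j) μ y ν y' t

/-- [folklore] **THE COVARIANCE HYPOTHESIS `hcov 1` OF `PerfectJetLetters.sPerf_letters_of_rows` FOR THE LITERAL's RAW STENCILS**, in its `((Lc^1 : ℕ) : ℤ)` spelling. -/
theorem JsB12Sym_S_translate_pow_one (j : ℕ) (κ : Fin 4) (u t : Fin 4 → ℤ) :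
    (JsB12Sym hLc Ncol tabs cΛ cB j).S κ (u + ((Lc ^ 1 : ℕ) : ℤ) • t) =
      ExpKernelCalculus.shiftK (-(((Lc ^ 1 : ℕ) : ℤ) • t)) ((JsB12Sym hLc Ncol tabs cΛ cB j).S κ u) := by
  simp only [pow_one]
  exact JsB12Sym_S_translate hLc Ncol tabs cΛ cB j κ u t

end Translate

end Summit.QuantumFields.BalabanUV.Beta.FP.RoadEndLeftUndressed

end
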